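import Summits.CriticalPhenomena.PercolationContinuityZ3.Theorems.PercNearOneGluingNoHeavyQuantKnTowerLower
import Mathlib.Analysis.Complex.ExponentialBounds
import HarnessLib
import HarnessLib.Audit.Tags

/-!
# QUANT lane R7 in the kernel: the FIRST SCALE of the explicit rate at `p_c(ℤ³)` is a tower `2^(2^(2^535783))`

builds on p205010 (kernel theorem, internal audit signed; external expert review pending)

Cell `prim-quant`, seat `prim-quant-p3` (generation 2).  CALIBRATION of the lane's explicit one-arm rate
`π_{p_c}(N) ≤ (1 - knEta d)^{iterCount (knLHi d) N}` (`Quant.oneArm_explicit_rate_criticalProbI`, p208976) at `d = 3`, complementing the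
kernel numerals for `knK` and `knEta 3` of `…QuantKnEtaNumeric.lean` (p4-g2) and `…QuantKnConstantsCertified.lean` (census-1 g3:
`3 334 289 807 000 ≤ knK ≤ 3 334 289 810 000`, `2^-12568 < knEta 3 < 2^-12567`) with the size of the FIRST SCALE `s₁ = knLHi 3 2` of the
scale sequence — the `N` below which the landed bound says nothing:

* `Quant.aknKappa_three_ge` — `2^22324 ≤ aknKappa 3 (1/64)` (its exponential factor is `exp(88604672/3969) ≥ exp 22324 ≥ 2^22324`, using only
  `exp 1 ≥ 2`); `Quant.dktN1_three_ge` — `2^178592 ≤ dktN1 3 (1/64)`; `Quant.knM_three_two_ge` — `2^178592 ≤ knM 3 2`;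
* `Quant.knLHi_three_two_ge` — **`2^(2^(2^(3·178592+7))) ≤ knLHi 3 2`** (`3·178592+7 = 535783`; exponents are written symbolically so that no
  tactic ever evaluates a literal power; the sharper external value is `log₂⁽³⁾ knLHi 3 1 ≈ 778 670`, QUANT.md §11.3 / CONSTANTS.md §3);
* `Quant.iterCount_knLHi_three_eq_zero` — for every `N < 2^(2^(2^(3·178592+7)))`, `iterCount (knLHi 3) N = 0`: below that `N` the landed bound
  reads `π_{p_c}(N) ≤ 1`.  "An explicit function tending to `0` and nothing more", as a kernel-certified number.
Nothing probabilistic is proved here (pure arithmetic on the closed forms of `…QuantKnConstants.lean`).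
-/

noncomputable section

namespace Summit.CriticalPhenomena.PercolationContinuityZ3.Theorems.Quant

open MeasureTheory Literature.Probability.Percolation Literature.Probability.LatticeModels
open Literature.Probability.Percolation.KozmaNitzan Literature.Probability.Percolation.AKN
open Literature.Probability.Percolation.GM (HOct)

/-! ## The first scale `knLHi 3 2` -/

/-- `critDelta 3 = 1/64`. builds on p205010 (kernel theorem, internal audit signed; external expert review pending). [folklore] -/
theorem critDelta_three : critDelta 3 = 1 / 64 := by unfold critDelta; norm_num

/-- `aknKappa 3 (1/64) ≥ 2^22324` (its exponential factor is `exp(88604672/3969) ≥ exp 22324 ≥ 2^22324`, using only `exp 1 ≥ 2`).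
builds on p205010 (kernel theorem, internal audit signed; external expert review pending). [folklore] -/
theorem aknKappa_three_ge : (2 : ℝ) ^ 22324 ≤ aknKappa 3 (1 / 64) := by
  unfold aknKappa
  refine le_trans ?_ (le_max_right _ _)
  refine le_trans ?_ (le_max_right _ _)
  have hE : (22324 : ℝ) ≤ (2 * (3 : ℕ) + 1 / 2 : ℝ) ^ 2 / (4 * (2 * (1 / 64 : ℝ) ^ 2 * (1 - 1 / 64) ^ 2)) := by norm_num
  have hexp : (2 : ℝ) ^ 22324 ≤ Real.exp ((2 * (3 : ℕ) + 1 / 2 : ℝ) ^ 2 / (4 * (2 * (1 / 64 : ℝ) ^ 2 * (1 - 1 / 64) ^ 2))) := by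
    have h2 : (2 : ℝ) ≤ Real.exp 1 := by have := Real.add_one_le_exp (1 : ℝ); linarith
    calc (2 : ℝ) ^ 22324 ≤ (Real.exp 1) ^ 22324 := pow_le_pow_left₀ (by norm_num) h2 _
      _ = Real.exp ((22324 : ℕ) * 1) := (Real.exp_nat_mul 1 22324).symm
      _ ≤ _ := Real.exp_le_exp.2 (by push_cast; linarith)
  have hpre : (1 : ℝ) ≤ (3 : ℝ) ^ (3 : ℕ) * (16 * ((3 : ℕ) : ℝ) ^ 2 / (1 / 64)) := by norm_num
  calc (2 : ℝ) ^ 22324 = 1 * 2 ^ 22324 := (one_mul _).symm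
    _ ≤ (3 : ℝ) ^ (3 : ℕ) * (16 * ((3 : ℕ) : ℝ) ^ 2 / (1 / 64)) *
        Real.exp ((2 * (3 : ℕ) + 1 / 2 : ℝ) ^ 2 / (4 * (2 * (1 / 64 : ℝ) ^ 2 * (1 - 1 / 64) ^ 2))) :=
        mul_le_mul hpre hexp (by positivity) (by positivity)

/-- `dktK 3 (1/64) ≥ aknKappa 3 (1/64)` (all other factors are `≥ 1`). builds on p205010 (kernel theorem, internal audit signed; external expert review pending). [folklore] -/
theorem aknKappa_le_dktK_three : aknKappa 3 (1 / 64) ≤ dktK 3 (1 / 64) := by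
  unfold dktK
  have hmin : min (1 / 64 : ℝ) (1 / 2) = 1 / 64 := by norm_num
  rw [hmin]
  have hκ : 0 ≤ aknKappa 3 (1 / 64) := le_trans (by norm_num) (three_le_aknKappa 3 (1 / 64))
  have h2 : (1 : ℝ) ≤ Real.sqrt 2 := Real.one_le_sqrt.2 (by norm_num)
  -- group the factors around `aknKappa`
  have hA : (1 : ℝ) ≤ (1 + 2 * ((3 : ℕ) : ℝ)) * (2 * ((3 : ℕ) : ℝ)) ^ (2 * 3) / (1 / 64 : ℝ) ^ (2 * 3 + 3) *
      7 ^ (4 * 3 ^ 2 + 4 * 3 : ℕ) := by norm_num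
  have hB : (1 : ℝ) ≤ ((3 : ℕ) : ℝ) * Real.sqrt 2 := by push_cast; nlinarith
  have hC : (1 : ℝ) ≤ (2 : ℝ) ^ (2 * 3) := by norm_num
  calc aknKappa 3 (1 / 64) = 1 * (1 * aknKappa 3 (1 / 64) * 1) * 1 := by ring
    _ ≤ (1 + 2 * ((3 : ℕ) : ℝ)) * (2 * ((3 : ℕ) : ℝ)) ^ (2 * 3) / (1 / 64 : ℝ) ^ (2 * 3 + 3) * 7 ^ (4 * 3 ^ 2 + 4 * 3 : ℕ) *
        (((3 : ℕ) : ℝ) * aknKappa 3 (1 / 64) * Real.sqrt 2) * 2 ^ (2 * 3) := by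
        have h3 : (1 : ℝ) ≤ ((3 : ℕ) : ℝ) := by norm_num
        gcongr
    _ = _ := by ring

/-- **`dktN1 3 (1/64) ≥ 2^178592`**. builds on p205010 (kernel theorem, internal audit signed; external expert review pending). [folklore] -/
theorem dktN1_three_ge : 2 ^ 178592 ≤ dktN1 3 (1 / 64) := by
  unfold dktN1
  refine le_max_of_le_right ?_
  have hκ := (aknKappa_three_ge).trans aknKappa_le_dktK_three
  have h0 : (0 : ℝ) ≤ 2 ^ 22324 := pow_nonneg (by norm_num) _
  have hK0 : (0 : ℝ) ≤ dktK 3 (1 / 64) := h0.trans hκ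
  have h18 : dktK 3 (1 / 64) ≤ 18 * dktK 3 (1 / 64) := by
    have := mul_le_mul_of_nonneg_right (show (1 : ℝ) ≤ 18 by norm_num) hK0
    rwa [one_mul] at this
  have hreal : ((2 ^ 178592 : ℕ) : ℝ) ≤ (18 * dktK 3 (1 / 64)) ^ 8 := by
    have hc : ((2 ^ 178592 : ℕ) : ℝ) = ((2 : ℝ) ^ 22324) ^ 8 := by
      rw [Nat.cast_pow, Nat.cast_ofNat, ← pow_mul, (by norm_num : 22324 * 8 = 178592)]
    rw [hc]
    exact (pow_le_pow_left₀ h0 hκ 8).trans (pow_le_pow_left₀ hK0 h18 8)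
  calc 2 ^ 178592 = ⌈((2 ^ 178592 : ℕ) : ℝ)⌉₊ := (Nat.ceil_natCast _).symm
    _ ≤ ⌈(18 * dktK 3 (1 / 64)) ^ 8⌉₊ := Nat.ceil_mono hreal

/-- `knM 3 2 ≥ 2^178592` (it exceeds `dktN1 3 (critDelta 3)`). builds on p205010 (kernel theorem, internal audit signed; external expert review pending). [folklore] -/
theorem knM_three_two_ge : 2 ^ 178592 ≤ knM 3 2 := by
  have h0 := dktN1_three_ge
  rw [← critDelta_three] at h0
  exact h0.trans ((dktN1_le_uniqScale 3 (critDelta 3) (knTauU 3) 2).trans (uniqScale_le_knM 3 2))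

/-- `seedBound 3 (knM 3 2) ≥ 2^(3a+5)` whenever `knM 3 2 ≥ 2^a` (exponents kept symbolic).
builds on p205010 (kernel theorem, internal audit signed; external expert review pending). [folklore] -/
theorem seedBound_three_ge_of_le {a : ℕ} (hM : 2 ^ a ≤ knM 3 2) : 2 ^ (3 * a + 5) ≤ seedBound 3 (knM 3 2) := by
  have hM2 : 2 ^ (a + 1) ≤ 2 * knM 3 2 + 3 := by
    rw [pow_succ']
    exact (Nat.mul_le_mul_left 2 hM).trans (Nat.le_add_right _ _)
  have h1 : (2 ^ (a + 1)) ^ 3 ≤ (2 * knM 3 2 + 3) ^ 3 := Nat.pow_le_pow_left hM2 3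
  have h7 : (2 : ℕ) ^ 2 ≤ 2 * 3 + 1 := by norm_num
  have hexp : 3 * a + 5 = 2 + (a + 1) * 3 := by ring
  unfold seedBound
  calc 2 ^ (3 * a + 5) = 2 ^ (2 + (a + 1) * 3) := by rw [hexp]
    _ = 2 ^ 2 * (2 ^ (a + 1)) ^ 3 := by rw [pow_add, pow_mul]
    _ ≤ (2 * 3 + 1) * (2 ^ (a + 1)) ^ 3 := Nat.mul_le_mul_right _ h7
    _ ≤ (2 * 3 + 1) * (2 * knM 3 2 + 3) ^ 3 := Nat.mul_le_mul_left _ h1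
    _ ≤ (2 * 3 + 1) * (2 * knM 3 2 + 3) ^ 3 + 1 := Nat.le_succ _

/-- `knLHi 3 2 ≥ 2^(2^(2^(3a+7)))` whenever `knM 3 2 ≥ 2^a`: seeds `≥ 2^(6·seedBound)`, levels `≥ 2^Ncont ≥ 2^knSeeds`.
builds on p205010 (kernel theorem, internal audit signed; external expert review pending).
[cite: KozmaNitzan2024, §4 Lemma 10 Steps II–III] -/
theorem knLHi_three_two_ge_of_le {a : ℕ} (hM : 2 ^ a ≤ knM 3 2) : 2 ^ (2 ^ (2 ^ (3 * a + 7))) ≤ knLHi 3 2 := by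
  have h36 : ∀ n : ℕ, n ≤ 12 * 3 * n := fun n => by omega
  have hd : 1 ≤ 3 := by norm_num
  have h1 := two_pow_Ncont_le_knLHi hd 2
  have h2 := knSeeds_le_Ncont 3 2
  have h3 := knSeeds_ge_two_pow hd 2
  have h4 := seedBound_three_ge_of_le hM
  have two_pos' : 0 < 2 := Nat.succ_pos 1
  have h46 : (2 : ℕ) ^ 2 ≤ 6 := by norm_num
  have hexp : 3 * a + 7 = 2 + (3 * a + 5) := by ring
  have h5 : 2 ^ (3 * a + 7) ≤ 6 * seedBound 3 (knM 3 2) :=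
    calc 2 ^ (3 * a + 7) = 2 ^ (2 + (3 * a + 5)) := by rw [hexp]
      _ = 2 ^ 2 * 2 ^ (3 * a + 5) := pow_add 2 2 (3 * a + 5)
      _ ≤ 6 * seedBound 3 (knM 3 2) := Nat.mul_le_mul h46 h4
  calc 2 ^ (2 ^ (2 ^ (3 * a + 7))) ≤ 2 ^ (2 ^ (6 * seedBound 3 (knM 3 2))) :=
        Nat.pow_le_pow_right two_pos' (Nat.pow_le_pow_right two_pos' h5)
    _ ≤ 2 ^ knSeeds 3 2 := Nat.pow_le_pow_right two_pos' h3
    _ ≤ 2 ^ LData.Ncont 3 (knM 3 2) (knSeeds 3 2) := Nat.pow_le_pow_right two_pos' h2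
    _ ≤ 2 ^ (12 * 3 * LData.Ncont 3 (knM 3 2) (knSeeds 3 2)) := Nat.pow_le_pow_right two_pos' (h36 _)
    _ ≤ knLHi 3 2 := h1

/-- **`knLHi 3 2 ≥ 2^(2^(2^535783))`**: the first scale `s₁` of the lane's rate at `d = 3` is a tower of three (huge)
exponentials (`535783 = 3·178592 + 7`).  builds on p205010 (kernel theorem, internal audit signed; external expert review pending).
[cite: KozmaNitzan2024, §4 Lemma 10 Steps II–III] -/
theorem knLHi_three_two_ge : 2 ^ (2 ^ (2 ^ (3 * 178592 + 7))) ≤ knLHi 3 2 :=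
  knLHi_three_two_ge_of_le knM_three_two_ge

/-- **The landed rate is vacuous below `2^(2^(2^535783))`**: for every such `N`, `iterCount (knLHi 3) N = 0`, i.e. the bound
`π_{p_c}(N) ≤ (1 - knEta 3)^{iterCount (knLHi 3) N}` of `Quant.oneArm_explicit_rate_criticalProbI` reads `π_{p_c}(N) ≤ 1` there.
An explicit function tending to `0` and nothing more — in numbers.
builds on p205010 (kernel theorem, internal audit signed; external expert review pending). [folklore] -/
theorem iterCount_knLHi_three_eq_zero {N : ℕ} (hN : N < 2 ^ (2 ^ (2 ^ (3 * 178592 + 7)))) :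
    iterCount (knLHi 3) N = 0 := by
  have hN' : N < (fun x : ℕ => 2 ^ (2 ^ (2 * x + 7)))^[0] (knLHi 3 2) := hN.trans_le knLHi_three_two_ge
  exact Nat.eq_zero_of_le_zero (iterCount_knLHi_le (d := 3) (Nat.le_of_ble_eq_true rfl) hN')

end Summit.CriticalPhenomena.PercolationContinuityZ3.Theorems.Quant
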